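import Literature.NumberTheory.IwasawaTheory.Greenberg2016.SpecialisedSUROfFacts
import HarnessLib

/-!
# Greenberg 2016 Prop. 4.1.1, case (c) — the conclusion "`S_𝓛(K, 𝐃)` is almost divisible" from
# [Gr4] Props. 5.2 / 6.3 / Thm. 1 (i) and [Gr5] Prop. 3.2.1 (c) (theorems only)

Topic `NumberTheory/IwasawaTheory/Greenberg2016`; namespace
`Literature.NumberTheory.IwasawaTheory.Greenberg2016`; THEOREMS ONLY (no definition, no named fact,
no `sorry`). Seat `bsd-input-gr16-prop411` (literature-prover, 2026-08-28).

The input `prop411_selmer_isAlmostDivisible` (Greenberg 2016 Prop. 4.1.1, named fact of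
`SelmerGroupStructure.lean`) is consumed in the tree only in case (c) (`prop411_selmer_isAlmostDivisible.caseC`,
`Λ = R = ℤ_p⟦T₁, T₂⟧`, `𝓛` full at `𝔭`). This file proves THAT CASE of its conclusion from print's
own inputs, all typed in the tree: (α) Prop. 2.6.1 = [Gr4] Thm. 1 (ii), granted the three named [Gr4]
facts `prop52_localH2_torsionBy_injective`, `prop63_shaAway_smul_surjective`, `thm1_sha2_isCoreflexive`
(`isAlmostDivisible_H_one_of_facts`); (β) §3.1–3.2 (`selmer_isAlmostDivisible_of_sur_torsionBy_prime`);
(γ') "`φ_Π` is surjective for almost all `Π`" in case (c) (`exists_finite_forall_sur_torsionBy_caseC_of_prop321`,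
`SpecialisedSUROfFacts.lean`), granted [Gr5] = Greenberg 2010 Prop. 3.2.1 (c) AT ITS PRINTED
GENERALITY as the inline hypothesis `h321` (see that file: the tree's named fact `prop263_sur_of_crk`
types the same proposition in the narrower `R`-cofree setting and is a special case of `h321`).

* `selmer_isAlmostDivisible_caseC_of_facts` — `S_𝓛(K, 𝐃)` is almost `Λ`-divisible, for
  `Λ ≃ ℤ_p⟦T₁,…,T_{m+1}⟧`, `𝐃` discrete `p`-primary cofree over a module-finite `Λ`-algebra `R`, RFX,
  LEO, LOC⁽²⁾ on `Σ`, `𝓛` almost divisible, CRK, and at a finite `η ∈ Σ`: LOC_η⁽¹⁾ and `Q_𝓛(K_η, 𝐃)`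
  coreflexive — granted `h52`, `h63`, `hT1`, `h321`;
* `selmer_noPseudoNull_caseC_of_facts` — the same in the consumers' reading (every Pontryagin dual of
  `S_𝓛(K, 𝐃)` has no non-zero pseudo-null submodule), the shape of `prop411_selmer_isAlmostDivisible.caseC`;
* primed versions `…'` — any number of variables `m ≥ 0` (binder `Nonempty (Λ ≃+* MvPowerSeries (Fin m) ℤ_[p])`
  as in `prop411_selmer_isAlmostDivisible`; for `m = 0` the specialisation step is vacuous).

Compared with the binders of `prop411_selmer_isAlmostDivisible`, the hypotheses "`Λ → R` injective",
"`R` complete Noetherian local with finite residue field of characteristic `p`", "`ρ` is `R`-linear",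
"`𝓛` is by `R`-submodules" are NOT needed here (they enter print only through Prop. 2.6.3's standing
setting, replaced by `h321`); the unprimed theorems are stated for `m + 1` variables (the `Λ_Π`-device),
the primed ones for any `m` (for `m = 0`, `Λ = ℤ_p`, every prime is associated with `p` and (γ') is vacuous).

HONESTY. CONDITIONAL on four INPUTS (`h52`, `h63`, `hT1`: named [Gr4] facts of the tree; `h321`:
[Gr5] Prop. 3.2.1 (c) as printed, inline). Nothing here proves Prop. 4.1.1 unconditionally or any
summit statement; BSD is not advanced. AI-typed, kernel-checked.

## References
* R. Greenberg, *On the structure of Selmer groups* (2016), Prop. 4.1.1 and its proof, pp. 15–17.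
  [Greenberg2016Selmer]
* R. Greenberg, *Surjectivity of the global-to-local map defining a Selmer group* (2010), Prop. 3.2.1.
  [Greenberg2010]
* R. Greenberg, *On the structure of certain Galois cohomology groups* (2006), Props. 5.2, 6.3, Thm. 1.
  [Greenberg2006]
-/

noncomputable section

open scoped Classical
open NumberField IsDedekindDomain Field IsLocalRing
open Literature.NumberTheory.GaloisRepresentations
open Literature.NumberTheory.IwasawaTheory.Greenberg2006
open Literature.NumberTheory.EllipticCurves (Module.IsPseudoNull)

namespace Literature.NumberTheory.IwasawaTheory.Greenberg2016

variable {p : ℕ} [Fact p.Prime] {K : Type} [Field K] [NumberField K]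
  (S : Set (HeightOneSpectrum (𝓞 K)))
  {Λ : Type} [CommRing Λ] [IsLocalRing Λ] [TopologicalSpace Λ] [IsTopologicalRing Λ]
  {D : Type} [AddCommGroup D] [Module Λ D] [TopologicalSpace D] [DiscreteTopology D]
  [ContinuousSMul Λ D] (ρ : ContinuousRep (GaloisGroupUnramifiedOutside K S) Λ D)

/-- **Greenberg 2016 Prop. 4.1.1, case (c): `S_𝓛(K, 𝐃)` is almost `Λ`-divisible — GRANTED [Gr4]
Props. 5.2 / 6.3 / Thm. 1 (i) (named facts) and [Gr5] Prop. 3.2.1 (c) at its printed generality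
(inline `h321`)**, for `Λ ≃ ℤ_p⟦T₁,…,T_{m+1}⟧`. Proof = print's: (α) `H¹(K_Σ/K, 𝐃)` almost divisible
(Prop. 2.6.1), (γ') `φ_{𝓛_Π}` onto for almost all `Π` (p. 16), (β) §3.1–3.2.
[cite: Greenberg2016Selmer, Prop. 4.1.1 (c) (§4.1 p. 15 L21–32); proof pp. 16–17] -/
theorem selmer_isAlmostDivisible_caseC_of_facts
    (h52 : prop52_localH2_torsionBy_injective) (h63 : prop63_shaAway_smul_surjective)
    (hT1 : thm1_sha2_isCoreflexive)
    (h321 : ∀ (P : Type) [CommRing P] [IsLocalRing P] [TopologicalSpace P] [IsTopologicalRing P]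
        (m' : ℕ), Nonempty (P ≃+* MvPowerSeries (Fin m') ℤ_[p]) →
      ∀ (D' : Type) [AddCommGroup D'] [Module P D'] [TopologicalSpace D'] [DiscreteTopology D']
        [ContinuousSMul P D'] (ρ' : ContinuousRep (GaloisGroupUnramifiedOutside K S) P D'),
        IsCofinitelyGenerated P D' → (∀ d : D', ∃ n : ℕ, (p ^ n : ℤ) • d = 0) →
      ∀ (L' : Specification S ρ'), IsDivisible P D' → LEO S ρ' → L'.CRK →
        (∃ η ∈ S, LOC1 S ρ' (Sum.inr η) ∧ IsDivisible P (L'.Q (Sum.inr η))) → L'.SUR)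
    (hS : S.Finite) (hSp : ∀ v : HeightOneSpectrum (𝓞 K), ((p : ℕ) : 𝓞 K) ∈ v.asIdeal → v ∈ S)
    {m₀ : ℕ} (e : Λ ≃+* MvPowerSeries (Fin (m₀ + 1)) ℤ_[p])
    {R : Type} [CommRing R] [Algebra Λ R] (hfin : Module.Finite Λ R)
    [Module R D] [IsScalarTower Λ R D] [SMulCommClass R Λ D]
    (hT : IsCofree R D) (hpD : ∀ d : D, ∃ n : ℕ, (p ^ n : ℤ) • d = 0)
    (L : Specification S ρ) (hRFX : RFX Λ D) (hLEO : LEO S ρ)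
    (hLOC2 : ∀ v : Place K, InSigma S v → LOC2 S ρ v)
    {η : HeightOneSpectrum (𝓞 K)} (hη : η ∈ S) (hLOC1 : LOC1 S ρ (Sum.inr η))
    (hL : L.IsAlmostDivisible) (hCRK : L.CRK) (hQ : IsCoreflexive Λ (L.Q (Sum.inr η))) :
    IsAlmostDivisible Λ L.selmer := by
  -- `𝐃` is cofinitely generated over `Λ` (cofree over `R`, `R` finite over `Λ`)
  haveI : IsScalarTower Λ R (CharacterModule D) := ⟨fun a r c ↦ by
    ext d
    simp only [CharacterModule.smul_apply, smul_assoc, smul_comm r a d]⟩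
  haveI : Module.Finite Λ R := hfin
  haveI : Module.Finite R (CharacterModule D) :=
    (hT _ (AddMonoidHom.id (CharacterModule D)) (isDualPairing_characterModule R D)).2
  have hD : IsCofinitelyGenerated Λ D :=
    isCofinitelyGenerated_iff_module_finite_characterModule.2 (Module.Finite.trans R _)
  -- (α): `H¹(K_Σ/K, 𝐃)` is almost divisible (Prop. 2.6.1, granted the three [Gr4] facts)
  have hH1 : IsAlmostDivisible Λ (ρ.H 1) :=
    isAlmostDivisible_H_one_of_facts h52 h63 hT1 hS hSp e ρ hpD hD hRFX hLEO hLOC2 hη hLOC1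
      (isCofinitelyGenerated_H_one S ρ e hD hS)
  -- (β) at primes, fed with (γ') in case (c)
  exact selmer_isAlmostDivisible_of_sur_torsionBy_prime S ρ hS e hD hRFX L hL hH1
    (exists_finite_forall_sur_torsionBy_caseC_of_prop321 S ρ h52 h63 hT1 h321 hS hSp e hfin hT
      hpD L hRFX hLEO hLOC2 hη hLOC1 hL hCRK hQ)

/-- The same in the consumers' reading (shape of `prop411_selmer_isAlmostDivisible.caseC`): every
Pontryagin dual of `S_𝓛(K, 𝐃)` has no non-zero pseudo-null `Λ`-submodule.
[cite: Greenberg2016Selmer, Prop. 4.1.1 (c) (§4.1 p. 15 L21–32)] -/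
theorem selmer_noPseudoNull_caseC_of_facts
    (h52 : prop52_localH2_torsionBy_injective) (h63 : prop63_shaAway_smul_surjective)
    (hT1 : thm1_sha2_isCoreflexive)
    (h321 : ∀ (P : Type) [CommRing P] [IsLocalRing P] [TopologicalSpace P] [IsTopologicalRing P]
        (m' : ℕ), Nonempty (P ≃+* MvPowerSeries (Fin m') ℤ_[p]) →
      ∀ (D' : Type) [AddCommGroup D'] [Module P D'] [TopologicalSpace D'] [DiscreteTopology D']
        [ContinuousSMul P D'] (ρ' : ContinuousRep (GaloisGroupUnramifiedOutside K S) P D'),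
        IsCofinitelyGenerated P D' → (∀ d : D', ∃ n : ℕ, (p ^ n : ℤ) • d = 0) →
      ∀ (L' : Specification S ρ'), IsDivisible P D' → LEO S ρ' → L'.CRK →
        (∃ η ∈ S, LOC1 S ρ' (Sum.inr η) ∧ IsDivisible P (L'.Q (Sum.inr η))) → L'.SUR)
    (hS : S.Finite) (hSp : ∀ v : HeightOneSpectrum (𝓞 K), ((p : ℕ) : 𝓞 K) ∈ v.asIdeal → v ∈ S)
    {m₀ : ℕ} (e : Λ ≃+* MvPowerSeries (Fin (m₀ + 1)) ℤ_[p])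
    {R : Type} [CommRing R] [Algebra Λ R] (hfin : Module.Finite Λ R)
    [Module R D] [IsScalarTower Λ R D] [SMulCommClass R Λ D]
    (hT : IsCofree R D) (hpD : ∀ d : D, ∃ n : ℕ, (p ^ n : ℤ) • d = 0)
    (L : Specification S ρ) (hRFX : RFX Λ D) (hLEO : LEO S ρ)
    (hLOC2 : ∀ v : Place K, InSigma S v → LOC2 S ρ v)
    {η : HeightOneSpectrum (𝓞 K)} (hη : η ∈ S) (hLOC1 : LOC1 S ρ (Sum.inr η))
    (hL : L.IsAlmostDivisible) (hCRK : L.CRK) (hQ : IsCoreflexive Λ (L.Q (Sum.inr η)))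
    {X : Type} [AddCommGroup X] [Module Λ X] {toDual : X →+ (L.selmer →+ AddCircle (1 : ℚ))}
    (hX : IsDualPairing Λ L.selmer toDual) {N : Submodule Λ X} (hN : Module.IsPseudoNull Λ N) :
    N = ⊥ :=
  (selmer_isAlmostDivisible_caseC_of_facts S ρ h52 h63 hT1 h321 hS hSp e hfin hT hpD L hRFX hLEO
    hLOC2 hη hLOC1 hL hCRK hQ).eq_bot_of_isPseudoNull hX hN

/-! ### Any number of variables: the case `Λ = ℤ_p` (`m = 0`) is vacuous -/

omit [IsLocalRing Λ] [TopologicalSpace Λ] [IsTopologicalRing Λ] in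
/-- For `Λ ≃ ℤ_p` (no variables) every non-unit is divisible by `p`: there is no prime `π` with
`(π) ≠ (p)`, so "almost all `Π ∈ Spec_{ht=1}(Λ)`" statements are vacuous there. [folklore] -/
private theorem natCast_dvd_of_ringEquiv_fin_zero (e : Λ ≃+* MvPowerSeries (Fin 0) ℤ_[p]) {π : Λ}
    (hπ : ¬ IsUnit π) : (p : Λ) ∣ π := by
  obtain ⟨a, ha⟩ := MvPowerSeries.C_surjective (σ := Fin 0) (R := ℤ_[p]) (e π)
  have hau : ¬ IsUnit a := fun hu ↦ hπ (by
    have h1 : IsUnit (e π) := by rw [← ha]; exact hu.map _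
    simpa using h1.map e.symm)
  have hdvd : (p : ℤ_[p]) ∣ a :=
    (PadicInt.norm_lt_one_iff_dvd a).1 (PadicInt.mem_nonunits.1 (mem_nonunits_iff.2 hau))
  have h1 : (p : MvPowerSeries (Fin 0) ℤ_[p]) ∣ e π := by
    rw [← ha, ← map_natCast (MvPowerSeries.C (σ := Fin 0) (R := ℤ_[p])) p]
    exact map_dvd _ hdvd
  simpa using map_dvd e.symm h1

/-- **(γ') in case (c), any number of variables** (`Λ ≃ ℤ_p⟦T₁,…,T_m⟧`, `m ≥ 0`; for `m = 0` the
exceptional set is a prime over `p` and the statement is vacuous), granted `h52`, `h63`, `hT1`, `h321`.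
[cite: Greenberg2016Selmer, proof of Prop. 4.1.1, p. 16 L1–37] [cite: Greenberg2010, Prop. 3.2.1 (p. 15)] -/
theorem exists_finite_forall_sur_torsionBy_caseC_of_prop321'
    (h52 : prop52_localH2_torsionBy_injective) (h63 : prop63_shaAway_smul_surjective)
    (hT1 : thm1_sha2_isCoreflexive)
    (h321 : ∀ (P : Type) [CommRing P] [IsLocalRing P] [TopologicalSpace P] [IsTopologicalRing P]
        (m' : ℕ), Nonempty (P ≃+* MvPowerSeries (Fin m') ℤ_[p]) →
      ∀ (D' : Type) [AddCommGroup D'] [Module P D'] [TopologicalSpace D'] [DiscreteTopology D']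
        [ContinuousSMul P D'] (ρ' : ContinuousRep (GaloisGroupUnramifiedOutside K S) P D'),
        IsCofinitelyGenerated P D' → (∀ d : D', ∃ n : ℕ, (p ^ n : ℤ) • d = 0) →
      ∀ (L' : Specification S ρ'), IsDivisible P D' → LEO S ρ' → L'.CRK →
        (∃ η ∈ S, LOC1 S ρ' (Sum.inr η) ∧ IsDivisible P (L'.Q (Sum.inr η))) → L'.SUR)
    (hS : S.Finite) (hSp : ∀ v : HeightOneSpectrum (𝓞 K), ((p : ℕ) : 𝓞 K) ∈ v.asIdeal → v ∈ S)
    {m : ℕ} (e : Λ ≃+* MvPowerSeries (Fin m) ℤ_[p])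
    {R : Type} [CommRing R] [Algebra Λ R] (hfin : Module.Finite Λ R)
    [Module R D] [IsScalarTower Λ R D] [SMulCommClass R Λ D]
    (hT : IsCofree R D) (hpD : ∀ d : D, ∃ n : ℕ, (p ^ n : ℤ) • d = 0)
    (L : Specification S ρ) (hRFX : RFX Λ D) (hLEO : LEO S ρ)
    (hLOC2 : ∀ v : Place K, InSigma S v → LOC2 S ρ v)
    {η : HeightOneSpectrum (𝓞 K)} (hη : η ∈ S) (hLOC1 : LOC1 S ρ (Sum.inr η))
    (hL : L.IsAlmostDivisible) (hCRK : L.CRK) (hQ : IsCoreflexive Λ (L.Q (Sum.inr η))) :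
    ∃ F : Set (PrimeSpectrum Λ), F.Finite ∧ (∀ P ∈ F, P.asIdeal.height ≤ 1) ∧
      ∀ π : Λ, Prime π → (∀ P ∈ F, π ∉ P.asIdeal) → Specification.SUR (S := S)
        (ρ := ρ.subrepresentation (Submodule.torsionBy Λ D π) (ρ.torsionBy_smul_le_comap π))
        (fun v ↦ (L v).comap (Hmap
          (localRep S (ρ.subrepresentation (Submodule.torsionBy Λ D π) (ρ.torsionBy_smul_le_comap π)) v)
          (localRep S ρ v) (Submodule.torsionBy Λ D π).subtypeL (fun _ _ ↦ rfl) 1)) := by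
  cases m with
  | zero =>
    haveI : IsNoetherianRing Λ := isNoetherianRing_of_ringEquiv_mvPowerSeries e
    have hpu : ¬ IsUnit (p : Λ) := by
      intro hu
      have hu' : IsUnit ((p : ℕ) : MvPowerSeries (Fin 0) ℤ_[p]) := by simpa using hu.map e
      rw [MvPowerSeries.isUnit_iff_constantCoeff, map_natCast] at hu'
      exact (PadicInt.irreducible_p (p := p)).not_isUnit hu'
    obtain ⟨Pp, hPp⟩ := (Ideal.span {(p : Λ)}).nonempty_minimalPrimes
      (Ideal.span_singleton_ne_top hpu)
    haveI hPpprime : Pp.IsPrime := hPp.1.1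
    refine ⟨{⟨Pp, hPpprime⟩}, Set.finite_singleton _, ?_, ?_⟩
    · intro P hP
      rw [Set.mem_singleton_iff] at hP
      subst hP
      exact Ideal.height_le_one_of_isPrincipal_of_mem_minimalPrimes (Ideal.span {(p : Λ)}) Pp hPp
    · intro π hπ hπF
      exact (hπF ⟨Pp, hPpprime⟩ (Set.mem_singleton _) (hPp.1.2 (Ideal.mem_span_singleton.2
        (natCast_dvd_of_ringEquiv_fin_zero e hπ.not_unit)))).elim
  | succ m₀ =>
    exact exists_finite_forall_sur_torsionBy_caseC_of_prop321 S ρ h52 h63 hT1 h321 hS hSp e hfin hT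
      hpD L hRFX hLEO hLOC2 hη hLOC1 hL hCRK hQ

/-- **Greenberg 2016 Prop. 4.1.1, case (c), any number of variables** (`Λ ≃ ℤ_p⟦T₁,…,T_m⟧`, `m ≥ 0`,
the binder shape `Nonempty (Λ ≃+* MvPowerSeries (Fin m) ℤ_[p])` of `prop411_selmer_isAlmostDivisible`):
`S_𝓛(K, 𝐃)` is almost `Λ`-divisible, granted `h52`, `h63`, `hT1`, `h321`.
[cite: Greenberg2016Selmer, Prop. 4.1.1 (c) (§4.1 p. 15 L21–32); proof pp. 16–17] -/
theorem selmer_isAlmostDivisible_caseC_of_facts'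
    (h52 : prop52_localH2_torsionBy_injective) (h63 : prop63_shaAway_smul_surjective)
    (hT1 : thm1_sha2_isCoreflexive)
    (h321 : ∀ (P : Type) [CommRing P] [IsLocalRing P] [TopologicalSpace P] [IsTopologicalRing P]
        (m' : ℕ), Nonempty (P ≃+* MvPowerSeries (Fin m') ℤ_[p]) →
      ∀ (D' : Type) [AddCommGroup D'] [Module P D'] [TopologicalSpace D'] [DiscreteTopology D']
        [ContinuousSMul P D'] (ρ' : ContinuousRep (GaloisGroupUnramifiedOutside K S) P D'),
        IsCofinitelyGenerated P D' → (∀ d : D', ∃ n : ℕ, (p ^ n : ℤ) • d = 0) →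
      ∀ (L' : Specification S ρ'), IsDivisible P D' → LEO S ρ' → L'.CRK →
        (∃ η ∈ S, LOC1 S ρ' (Sum.inr η) ∧ IsDivisible P (L'.Q (Sum.inr η))) → L'.SUR)
    (hS : S.Finite) (hSp : ∀ v : HeightOneSpectrum (𝓞 K), ((p : ℕ) : 𝓞 K) ∈ v.asIdeal → v ∈ S)
    {m : ℕ} (hΛ : Nonempty (Λ ≃+* MvPowerSeries (Fin m) ℤ_[p]))
    {R : Type} [CommRing R] [Algebra Λ R] (hfin : Module.Finite Λ R)
    [Module R D] [IsScalarTower Λ R D] [SMulCommClass R Λ D]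
    (hT : IsCofree R D) (hpD : ∀ d : D, ∃ n : ℕ, (p ^ n : ℤ) • d = 0)
    (L : Specification S ρ) (hRFX : RFX Λ D) (hLEO : LEO S ρ)
    (hLOC2 : ∀ v : Place K, InSigma S v → LOC2 S ρ v)
    {η : HeightOneSpectrum (𝓞 K)} (hη : η ∈ S) (hLOC1 : LOC1 S ρ (Sum.inr η))
    (hL : L.IsAlmostDivisible) (hCRK : L.CRK) (hQ : IsCoreflexive Λ (L.Q (Sum.inr η))) :
    IsAlmostDivisible Λ L.selmer := by
  obtain ⟨e⟩ := hΛ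
  -- `𝐃` is cofinitely generated over `Λ`
  haveI : IsScalarTower Λ R (CharacterModule D) := ⟨fun a r c ↦ by
    ext d
    simp only [CharacterModule.smul_apply, smul_assoc, smul_comm r a d]⟩
  haveI : Module.Finite Λ R := hfin
  haveI : Module.Finite R (CharacterModule D) :=
    (hT _ (AddMonoidHom.id (CharacterModule D)) (isDualPairing_characterModule R D)).2
  have hD : IsCofinitelyGenerated Λ D :=
    isCofinitelyGenerated_iff_module_finite_characterModule.2 (Module.Finite.trans R _)
  have hH1 : IsAlmostDivisible Λ (ρ.H 1) :=
    isAlmostDivisible_H_one_of_facts h52 h63 hT1 hS hSp e ρ hpD hD hRFX hLEO hLOC2 hη hLOC1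
      (isCofinitelyGenerated_H_one S ρ e hD hS)
  exact selmer_isAlmostDivisible_of_sur_torsionBy_prime S ρ hS e hD hRFX L hL hH1
    (exists_finite_forall_sur_torsionBy_caseC_of_prop321' S ρ h52 h63 hT1 h321 hS hSp e hfin hT
      hpD L hRFX hLEO hLOC2 hη hLOC1 hL hCRK hQ)

/-- **The consumers' reading, any number of variables** (shape of `prop411_selmer_isAlmostDivisible.caseC`,
binder `Nonempty (Λ ≃+* MvPowerSeries (Fin m) ℤ_[p])`): every Pontryagin dual of `S_𝓛(K, 𝐃)` has no
non-zero pseudo-null `Λ`-submodule, granted `h52`, `h63`, `hT1`, `h321`.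
[cite: Greenberg2016Selmer, Prop. 4.1.1 (c) (§4.1 p. 15 L21–32)] -/
theorem selmer_noPseudoNull_caseC_of_facts'
    (h52 : prop52_localH2_torsionBy_injective) (h63 : prop63_shaAway_smul_surjective)
    (hT1 : thm1_sha2_isCoreflexive)
    (h321 : ∀ (P : Type) [CommRing P] [IsLocalRing P] [TopologicalSpace P] [IsTopologicalRing P]
        (m' : ℕ), Nonempty (P ≃+* MvPowerSeries (Fin m') ℤ_[p]) →
      ∀ (D' : Type) [AddCommGroup D'] [Module P D'] [TopologicalSpace D'] [DiscreteTopology D']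
        [ContinuousSMul P D'] (ρ' : ContinuousRep (GaloisGroupUnramifiedOutside K S) P D'),
        IsCofinitelyGenerated P D' → (∀ d : D', ∃ n : ℕ, (p ^ n : ℤ) • d = 0) →
      ∀ (L' : Specification S ρ'), IsDivisible P D' → LEO S ρ' → L'.CRK →
        (∃ η ∈ S, LOC1 S ρ' (Sum.inr η) ∧ IsDivisible P (L'.Q (Sum.inr η))) → L'.SUR)
    (hS : S.Finite) (hSp : ∀ v : HeightOneSpectrum (𝓞 K), ((p : ℕ) : 𝓞 K) ∈ v.asIdeal → v ∈ S)
    {m : ℕ} (hΛ : Nonempty (Λ ≃+* MvPowerSeries (Fin m) ℤ_[p]))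
    {R : Type} [CommRing R] [Algebra Λ R] (hfin : Module.Finite Λ R)
    [Module R D] [IsScalarTower Λ R D] [SMulCommClass R Λ D]
    (hT : IsCofree R D) (hpD : ∀ d : D, ∃ n : ℕ, (p ^ n : ℤ) • d = 0)
    (L : Specification S ρ) (hRFX : RFX Λ D) (hLEO : LEO S ρ)
    (hLOC2 : ∀ v : Place K, InSigma S v → LOC2 S ρ v)
    {η : HeightOneSpectrum (𝓞 K)} (hη : η ∈ S) (hLOC1 : LOC1 S ρ (Sum.inr η))
    (hL : L.IsAlmostDivisible) (hCRK : L.CRK) (hQ : IsCoreflexive Λ (L.Q (Sum.inr η)))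
    {X : Type} [AddCommGroup X] [Module Λ X] {toDual : X →+ (L.selmer →+ AddCircle (1 : ℚ))}
    (hX : IsDualPairing Λ L.selmer toDual) {N : Submodule Λ X} (hN : Module.IsPseudoNull Λ N) :
    N = ⊥ :=
  (selmer_isAlmostDivisible_caseC_of_facts' S ρ h52 h63 hT1 h321 hS hSp hΛ hfin hT hpD L hRFX hLEO
    hLOC2 hη hLOC1 hL hCRK hQ).eq_bot_of_isPseudoNull hX hN

end Literature.NumberTheory.IwasawaTheory.Greenberg2016

end
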